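import Mathlib
import HarnessLib
import Summits.HubbardSuperconductivity.HubbardSuperconductivity.Theorems.KLProgrammeKLRegimeEngineV8TowerExports
import Summits.HubbardSuperconductivity.HubbardSuperconductivity.Theorems.KLProgrammeKLRegimeEngineV8DefsQ7
import Summits.HubbardSuperconductivity.HubbardSuperconductivity.Theorems.KLProgrammeKLRegimeWickDressedStep

/-!
# Route `KLProgramme` — ENGINE child gen 8 (stmt-HubbardSuperconductivity-20437 `KLRegimeEngineV17F2`), SKELETON v2 class #3 (plan g17 (R47b)/(R47c)/(R47h)):
# the E.5 SHARE of stub (c)'s `eremBar` budget — `E5ShareStep`, the deferred `klE5Raise` / `klE5ShareU`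
# (cell gate-hubbard-kl, seat p5 g6; objects of the (R1′)-continuous organisation of record named by p1 g11, KL STATUS 2026-08-27T14:29:19Z)

WHY.  (E5-CR)/(R47): the two-vertex classes with `k ≥ 3` lines (E.5) of the within-slice source are budgeted by `Q.CR·(P.Klam·|U|)³·2^{−n}`; their share
`C` is not a closed term before the line data (L1/L2) and the U-currency table (`klCU`, class #1) are instantiated, so — per (R47b)'s principle — it is
DEFERRED: `klE5Raise P R := (choose (∃ (C,u), …E5ShareStep P R C u)).1` (else `0`), read by `klEngQ8 := (klEngQ7 P R).withCR (max … (klE5Raise P R))`,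
and the threshold `klE5ShareU` by `klEngU₀10`.

THE OBJECTS (step `n−1 → n` at the FIXED flow frame `K = K_n`, (R1′) dressed lines, continuous in the cutoff `Λ ∈ [Λ_n, Λ_{n−1}]`; p1 g10/g11:
`klw_wickAction_succ_dressed`, `klws_hasDerivAt_dressedSliceCov(_of_mem)`, `klws_pairKernel_flowData_of_covCurve`):
* `klE5SliceSym … K n₀ Λ` — the symbol `s_Λ` of the partial slice `C^K_{>Λ} − C^K_{>Λ_{n₀}}` (`klw_sliceCov_succ_eq_normalCovariance` at `Λ = Λ_{n₀+1}`),
  `klE5SliceSymDeriv` its `Λ`-derivative symbol; `klE5Kappa … K n₀` — the self-energy symbol `κ = 2·kernel 𝒱_{n₀}[K] 2 (ψ̂⁺ψ̂⁻)`;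
* for a dressing symbol `κ`: `klE5DressedSlice … κ Λ = normalCovariance (s_Λ/(1+s_Λκ))` (`C_Λ`), `klE5DressedSliceDeriv … κ Λ = normalCovariance (ṡ_Λ/(1+s_Λκ)²)`
  (`Ċ_Λ`, chain rule), `klE5Dress` (`m = (1 + s_{Λ_{n₀+1}}κ)⁻¹`), `klE5DressedSoft = of (m X·m Y·klSoftCov (n₀+1) X Y)` (`Dm`), `klE5Total = Dm + C_{Λ_{n₀+1}}`
  (`C∞`), `klE5Input = 𝒱_{n₀}[K] − presented (kernel 𝒱_{n₀}[K] 2)` (`V′`), `klE5Carrier … κ V Λ = e^{Δ_{C∞ − C_Λ}}·effAction C_Λ V` (`W_Λ`);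
* **`klE5Block … κ V Λ Qm x y`** = `𝒱₄(dblFold(Δ_×(Ċ_Λ)((Σ_{2 ≤ i ≤ |idx|+1} (i!)⁻¹ Δ_×(C∞ − C_Λ)^i)(W_Λ⁰ W_Λ¹))))` at the pair-label tuple of
  `klws_flow_source_eq` — the `l ≥ 2` block of the source per unit `dΛ` (the `(Λ_n − Λ_{n−1})` Jacobian of `t ↦ Λ(t)` is the slice measure below);
  the dressing symbol `κ` and the input `V` are PARAMETERS: **`klE5BlockR1`** (`κ := klE5Kappa`, `V := klE5Input` — the (R1′) organisation of record,
  used in `E5ShareStep`) and **`klE5BlockBare`** (`κ := 0`, `V := 𝒱_{n₀}[K]` — the bare organisation of `klws_flow_source_eq`).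
* **`E5ShareStep P R C u`** — ∀ `G` (`G.WF`), ∀ `r ≥ (klEngQ7 P R).CR`, stub binders (doors `klEngC₃6`, `klEngU₀9`, `U ≤ u r cc`, `klEngL₃`, `klEngM₃`,
  `1 ≤ n ≤ nScales β + 1`, `IsKLRegime`), `HistP klPredsV17F2 … G P ((klEngQ7 P R).withCR r) R … 0 n`, `FrameOK … (K_n)`, the class-#1 exports
  `∀ j ≤ n, LevelsUExportAt … (klCU P R (klEngQ7 P R)) … j` ⟹ for every `Λ ∈ [Λ_n, Λ_{n−1}]`, every `Qm` and all labels `x y` over the bare ball: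
  `‖klE5Block … Λ Qm x y‖·(Λ_{n−1} − Λ_n) ≤ C·(P.Klam·U)³·2^{−n}`;
* `IsE5Pkg`, the dite `klE5Pkg` → **`klE5Raise`**, **`klE5ShareU`**, `klE5Raise_nonneg`, `klE5ShareU_pos` (unconditional), **`e5ShareStep_klE5Raise_of_exists/_of`**;
* §3 the BARE-lines twin `E5ShareStepBare` (over `klE5BlockBare`) with its own deferred pair `klE5RaiseBare/klE5ShareUBare` (+ lemmas) — so that either
  ruling on the (c) lane's line organisation ((R47h)(2)) needs no further definition; `klEngQ8` reads the name the pen rules (default `klE5Raise`).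

Definitions with bodies + bookkeeping; nothing about the model's sizes is asserted; nothing asserts superconductivity.  RECIPE for the later `∃ (C,u)`
witness: HOME/prover-p5/E5-GAIN-SCALE-N.md §12 (e′ = 2 per colouring; p532413 + p536381 + p533230 + p539100).
-/

noncomputable section

namespace Summit.HubbardSuperconductivity.HubbardSuperconductivity.Theorems.KLRegimeSplit

set_option linter.dupNamespace false -- summit = problem name (single-conjunct summit), D-0017

open Real Finset Literature.MathematicalPhysics.QuantumLattice Literature.Probability.LatticeModels GrassmannAlgebra Matrix
open Literature.MathematicalPhysics.QuantumLattice.FermiRG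
open Summit.HubbardSuperconductivity.HubbardSuperconductivity.Theorems.KLProgrammeLegKernels
open Summit.HubbardSuperconductivity.HubbardSuperconductivity.Theorems.DispersionFlow
open Summit.HubbardSuperconductivity.HubbardSuperconductivity.Theorems.EngineV8
open Summit.HubbardSuperconductivity.HubbardSuperconductivity.Theorems.KLRegimeWick
open Summit.HubbardSuperconductivity.HubbardSuperconductivity.Theorems.TwoPointAssembly

/-! ## §1 The (R1′)-continuous objects of the step `n₀ → n₀+1` at a fixed frame `K` -/

section Objects

variable (L M : ℕ) [NeZero L] [NeZero M] (β U μ : ℝ) (K : TrigPolyC4v) (n₀ : ℕ)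

/-- The partial-slice symbol `s_Λ(k,σ) = (w^K_Λ(k) − w^K_{Λ_{n₀}}(k))·βL²·(iω + e_K)/nambuDen` (at `Λ = Λ_{n₀+1}`: the symbol of `klSliceCov … (n₀+1)`,
`klw_sliceCov_succ_eq_normalCovariance`). -/
def klE5SliceSym (Λ : ℝ) (ks : FreqMomentum L M × Fin 2) : ℂ :=
  ((hubbardCutoffWeightCT L M β μ K Λ ks.1 : ℂ) - (hubbardCutoffWeightCT L M β μ K (klScale klE0 n₀) ks.1 : ℂ)) *
    (((β * (L : ℝ) ^ 2 : ℝ) : ℂ) * ((Complex.I * matsubaraFreq β M ks.1.1 + nambuXiCT L μ K ks.1.2) / nambuDenCT L M β μ 0 K ks.1))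

/-- The `Λ`-derivative of the partial-slice symbol: `ṡ_Λ = (∂_Λ w^K_Λ)·βL²·(iω + e_K)/nambuDen`. -/
def klE5SliceSymDeriv (Λ : ℝ) (ks : FreqMomentum L M × Fin 2) : ℂ :=
  ((deriv (fun Λ' : ℝ => hubbardCutoffWeightCT L M β μ K Λ' ks.1) Λ : ℝ) : ℂ) *
    (((β * (L : ℝ) ^ 2 : ℝ) : ℂ) * ((Complex.I * matsubaraFreq β M ks.1.1 + nambuXiCT L μ K ks.1.2) / nambuDenCT L M β μ 0 K ks.1))

/-- The self-energy symbol of the input action `𝒱_{n₀}[K]`: `κ(k,σ) = 2·kernel 𝒱 2 (ψ̂⁺_{kσ}, ψ̂⁻_{kσ})` (`klw_wickAction_succ_dressed`'s `hκ`). -/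
def klE5Kappa (ks : FreqMomentum L M × Fin 2) : ℂ :=
  2 * kernel ℂ (klEffectiveAction L M β U μ K klE0 n₀) 2 ![((ks, 0) : HubbardFieldIdx L M), (ks, 1)]

variable (κ : FreqMomentum L M × Fin 2 → ℂ)

/-- The partial slice DRESSED by a symbol `κ`: `C_Λ = normalCovariance (s_Λ/(1 + s_Λκ))` (`κ = klE5Kappa …`: the (R1′) lines,
`klws_hasDerivAt_dressedSliceCov`; `κ = 0`: the BARE partial slice `C^K_{>Λ} − C^K_{>Λ_{n₀}}`). -/
def klE5DressedSlice (Λ : ℝ) : Matrix (HubbardFieldIdx L M) (HubbardFieldIdx L M) ℂ :=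
  normalCovariance L M fun ks => klE5SliceSym L M β μ K n₀ Λ ks / (1 + klE5SliceSym L M β μ K n₀ Λ ks * κ ks)

/-- Its `Λ`-derivative `Ċ_Λ = normalCovariance (ṡ_Λ/(1 + s_Λκ)²)` (chain rule; the line-`0` symbol of the E.5 block). -/
def klE5DressedSliceDeriv (Λ : ℝ) : Matrix (HubbardFieldIdx L M) (HubbardFieldIdx L M) ℂ :=
  normalCovariance L M fun ks => klE5SliceSymDeriv L M β μ K Λ ks / (1 + klE5SliceSym L M β μ K n₀ Λ ks * κ ks) ^ 2

/-- The dressing multiplier `m(X) = (1 + s_{Λ_{n₀+1}}(X)·κ(X))⁻¹` (`klw_wickAction_succ_dressed`'s `hm`; `= 1` for `κ = 0`). -/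
def klE5Dress (X : HubbardFieldIdx L M) : ℂ := (1 + klE5SliceSym L M β μ K n₀ (klScale klE0 (n₀ + 1)) X.1 * κ X.1)⁻¹

/-- The dressed soft covariance `Dm = of (m X · m Y · klSoftCov (n₀+1) X Y)` (`hDm`; `= klSoftCov (n₀+1)` for `κ = 0`). -/
def klE5DressedSoft : Matrix (HubbardFieldIdx L M) (HubbardFieldIdx L M) ℂ :=
  Matrix.of fun X Y => klE5Dress L M β μ K n₀ κ X * klE5Dress L M β μ K n₀ κ Y * klSoftCov L M β μ K (n₀ + 1) X Y

/-- The total covariance of the step `C∞ = Dm + C_{Λ_{n₀+1}}` (`gaussConv ℂ (Dm + gt)`). -/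
def klE5Total : Matrix (HubbardFieldIdx L M) (HubbardFieldIdx L M) ℂ :=
  klE5DressedSoft L M β μ K n₀ κ + klE5DressedSlice L M β μ K n₀ κ (klScale klE0 (n₀ + 1))

/-- The two-leg-free input `V′ = 𝒱_{n₀}[K] − presented (kernel 𝒱_{n₀}[K] 2)` (`hQ`, `hV'`). -/
def klE5Input : HubbardGrassmann L M :=
  klEffectiveAction L M β U μ K klE0 n₀ - presented ℂ (kernel ℂ (klEffectiveAction L M β U μ K klE0 n₀) 2)

/-- The Wick carrier along the slice `W_Λ = e^{Δ_{C∞ − C_Λ}}·effAction C_Λ V` for an input `V` (`klws_pairKernel_flowData_of_covCurve`'s carrier;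
(R1′): `V = klE5Input …`; bare organisation: `V = 𝒱_{n₀}[K]`). -/
def klE5Carrier (V : HubbardGrassmann L M) (Λ : ℝ) : HubbardGrassmann L M :=
  gaussConv ℂ (klE5Total L M β μ K n₀ κ - klE5DressedSlice L M β μ K n₀ κ Λ) (effAction ℂ (klE5DressedSlice L M β μ K n₀ κ Λ) V)

/-- **The E.5 block** of the within-slice source per unit `dΛ` at cutoff `Λ` and pair labels `(Qm; x, y)`, for dressing `κ` and input `V`: the `l ≥ 2` part
`𝒱₄(dblFold(Δ_×(Ċ_Λ)((Σ_{2 ≤ i ≤ |HubbardFieldIdx × Fin 2|+1} (i!)⁻¹·Δ_×(C∞ − C_Λ)^i)(W_Λ⁰·W_Λ¹))))` at the label tuple of `klws_flow_source_eq`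
(`e^{Δ_×(D)} = Σ_{i<|idx|+2}(i!)⁻¹Δ_×(D)^i`, `gaussConv_eq_sum_range`; `i = 0, 1` are the one-line and ladder/bubble classes, not E.5). -/
def klE5Block (V : HubbardGrassmann L M) (Λ : ℝ) (Qm : TorusSite 2 L) (x y : TorusSite 2 L × MatsubaraIdx M) : ℂ :=
  vertexFn L M β
    (dblFold ℂ (grassmannLaplacian ℂ (crossCov ℂ (klE5DressedSliceDeriv L M β μ K n₀ κ Λ))
      ((∑ i ∈ Finset.Icc 2 (Fintype.card (HubbardFieldIdx L M × Fin 2) + 1),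
          ((i.factorial : ℂ))⁻¹ • grassmannLaplacian ℂ (crossCov ℂ (klE5Total L M β μ K n₀ κ - klE5DressedSlice L M β μ K n₀ κ Λ)) ^ i)
        (dblCopy ℂ 0 (klE5Carrier L M β μ K n₀ κ V Λ) * dblCopy ℂ 1 (klE5Carrier L M β μ K n₀ κ V Λ)))))
    4 ![(((y.2, y.1), 0), 0), (((y.2.rev, Qm - y.1), 1), 0), (((x.2.rev, Qm - x.1), 1), 1), (((x.2, x.1), 0), 1)]

/-- **The (R1′) E.5 block** of the step `n₀ → n₀+1` at frame `K`: dressing `κ := klE5Kappa` (the input's self-energy symbol), input `V′ := klE5Input`. -/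
def klE5BlockR1 (Λ : ℝ) (Qm : TorusSite 2 L) (x y : TorusSite 2 L × MatsubaraIdx M) : ℂ :=
  klE5Block L M β μ K n₀ (klE5Kappa L M β U μ K n₀) (klE5Input L M β U μ K n₀) Λ Qm x y

/-- **The BARE E.5 block** (bare partial-slice lines, input the full `𝒱_{n₀}[K]` — the organisation of `klws_flow_source_eq`): `κ := 0`. -/
def klE5BlockBare (Λ : ℝ) (Qm : TorusSite 2 L) (x y : TorusSite 2 L × MatsubaraIdx M) : ℂ :=
  klE5Block L M β μ K n₀ (fun _ => 0) (klEffectiveAction L M β U μ K klE0 n₀) Λ Qm x y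

end Objects

/-! ### The block as the sum of its line-number terms (linearity; the shape `…TailPushforward` / `…GramTailValue` consume) -/

section BlockSum

variable (L M : ℕ) [NeZero L] (β μ : ℝ) (K : TrigPolyC4v) (n₀ : ℕ) (κ : FreqMomentum L M × Fin 2 → ℂ)

/-- **`klE5Block` is the weighted sum of its `i`-line terms**: `Σ_{i∈Icc 2 (|idx|+1)} (i!)⁻¹ · 𝒱₄(dblFold(Δ_×(Ċ_Λ)(Δ_×(C∞ − C_Λ)^i (W⁰W¹))))` — each summand
is one application of `dblFold_crossLaplacian_mul_pow_map` / `listProd_ite_zero_eq_pow_mul` (`k = i + 1` lines: `Ċ_Λ` and `i` copies of `C∞ − C_Λ`). -/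
theorem klE5Block_eq_sum (V : HubbardGrassmann L M) (Λ : ℝ) (Qm : TorusSite 2 L) (x y : TorusSite 2 L × MatsubaraIdx M) :
    klE5Block L M β μ K n₀ κ V Λ Qm x y =
      ∑ i ∈ Finset.Icc 2 (Fintype.card (HubbardFieldIdx L M × Fin 2) + 1), ((i.factorial : ℂ))⁻¹ *
        vertexFn L M β
          (dblFold ℂ (grassmannLaplacian ℂ (crossCov ℂ (klE5DressedSliceDeriv L M β μ K n₀ κ Λ))
            ((grassmannLaplacian ℂ (crossCov ℂ (klE5Total L M β μ K n₀ κ - klE5DressedSlice L M β μ K n₀ κ Λ)) ^ i)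
              (dblCopy ℂ 0 (klE5Carrier L M β μ K n₀ κ V Λ) * dblCopy ℂ 1 (klE5Carrier L M β μ K n₀ κ V Λ)))))
          4 ![(((y.2, y.1), 0), 0), (((y.2.rev, Qm - y.1), 1), 0), (((x.2.rev, Qm - x.1), 1), 1), (((x.2, x.1), 0), 1)] := by
  unfold klE5Block
  rw [LinearMap.sum_apply, map_sum, map_sum, vertexFn_def, kernel_sum, Finset.mul_sum]
  refine Finset.sum_congr rfl fun i _ => ?_
  rw [LinearMap.smul_apply, map_smul, map_smul, kernel_smul, vertexFn_def]
  ring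

end BlockSum

/-! ## §2 The step Prop and the deferred pair -/

/-- **`E5ShareStep P R C u`** — the E.5 share of `eremBar`: for every geometry package `G` (`G.WF`), every raised `r ≥ (klEngQ7 P R).CR`, under the stub
binders of the engine-flow skeleton and below the deferred threshold `u r cc`, the history at `(klEngQ7 P R).withCR r`, the admissibility of `K_n` and the
class-#1 U-currency exports at every `j ≤ n` bound the E.5 block of the step `n−1 → n` at frame `K_n` at every cutoff of the slice, every total momentum
and all labels over the bare ball, times the slice measure, by `C·(P.Klam·U)³·2^{−n}`. -/
def E5ShareStep (P : SplitConsts) (R : RenConsts) (C : ℝ) (u : ℝ → ℝ → ℝ) : Prop :=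
  ∀ G : GeoConsts, G.WF → ∀ r : ℝ, (klEngQ7 P R).CR ≤ r →
    ∀ cc : ℝ, 0 < cc → cc ≤ klEngC₃6 P R →
      ∀ μ ∈ klWindowC, ∀ U : ℝ, 0 < U → U ≤ klEngU₀9 P R cc → U ≤ u r cc →
        ∀ β : ℝ, klBetaMin ≤ β → β ≤ Real.exp (cc / U ^ 2) →
          ∀ (L M : ℕ) [NeZero L] [NeZero M], klEngL₃ β U ≤ L → klEngM₃ β U L ≤ M →
            ∀ n : ℕ, 1 ≤ n → n ≤ nScales β + 1 → IsKLRegime U cc (-(n : ℤ)) →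
              HistP klPredsV17F2 L M G P ((klEngQ7 P R).withCR r) R β U μ 0 n →
                FrameOK R U (nScales β) μ (klFlowFrameU L M β U μ n) →
                  (∀ j ≤ n, LevelsUExportAt L M (klCU P R (klEngQ7 P R)) P β U μ j) →
                    ∀ Λ ∈ Set.Icc (klScale klE0 n) (klScale klE0 (n - 1)), ∀ Qm : TorusSite 2 L,
                      ∀ x y : TorusSite 2 L × MatsubaraIdx M, x.1 ∈ klBall L μ 0 → y.1 ∈ klBall L μ 0 →
                        ‖klE5BlockR1 L M β U μ (klFlowFrameU L M β U μ n) (n - 1) Λ Qm x y‖ * (klScale klE0 (n - 1) - klScale klE0 n) ≤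
                          C * (P.Klam * U) ^ 3 * ((2 : ℝ) ^ n)⁻¹

/-- An admissible E.5 package: nonnegative share, positive threshold function. -/
def IsE5Pkg (e : ℝ × (ℝ → ℝ → ℝ)) : Prop := 0 ≤ e.1 ∧ ∀ r cc, 0 < e.2 r cc

/-- The trivial package (share `0`, threshold `1`) is admissible. -/
theorem isE5Pkg_zero : IsE5Pkg (0, fun _ _ => 1) := ⟨le_rfl, fun _ _ => one_pos⟩

section Deferred

variable (P : SplitConsts) (R : RenConsts)

/-- The deferred E.5 package: SOME admissible `(C, u)` for which the step holds, if one exists, else the trivial package. -/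
def klE5Pkg : ℝ × (ℝ → ℝ → ℝ) :=
  open scoped Classical in
  if h : ∃ e : ℝ × (ℝ → ℝ → ℝ), IsE5Pkg e ∧ E5ShareStep P R e.1 e.2 then Classical.choose h else (0, fun _ _ => 1)

/-- **`klE5Raise P R`** — the deferred E.5 share of `CR` (read by `klEngQ8 P R := (klEngQ7 P R).withCR (max (klEngQ7 P R).CR (klE5Raise P R))`). -/
def klE5Raise : ℝ := (klE5Pkg P R).1

/-- **`klE5ShareU P R r cc`** — the deferred coupling threshold of the E.5 bound (one of `klEngU₀10`'s `min` terms, at `r := (klEngQ8 P R).CR`). -/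
def klE5ShareU : ℝ → ℝ → ℝ := (klE5Pkg P R).2

/-- The deferred package is admissible (unconditionally). -/
theorem isE5Pkg_klE5Pkg : IsE5Pkg (klE5Pkg P R) := by
  classical
  unfold klE5Pkg
  split_ifs with h
  · exact (Classical.choose_spec h).1
  · exact isE5Pkg_zero

/-- `0 ≤ klE5Raise P R`. -/
theorem klE5Raise_nonneg : 0 ≤ klE5Raise P R := (isE5Pkg_klE5Pkg P R).1

/-- `0 < klE5ShareU P R r cc` — so a `min` with it keeps a U-door positive. -/
theorem klE5ShareU_pos (r cc : ℝ) : 0 < klE5ShareU P R r cc := (isE5Pkg_klE5Pkg P R).2 r cc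

variable {P R}

/-- **The step holds for the deferred pair as soon as it holds for some admissible package.** -/
theorem e5ShareStep_klE5Raise_of_exists (h : ∃ e : ℝ × (ℝ → ℝ → ℝ), IsE5Pkg e ∧ E5ShareStep P R e.1 e.2) :
    E5ShareStep P R (klE5Raise P R) (klE5ShareU P R) := by
  classical
  have hpkg : klE5Pkg P R = Classical.choose h := by
    unfold klE5Pkg
    rw [dif_pos h]
  unfold klE5Raise klE5ShareU
  rw [hpkg]
  exact (Classical.choose_spec h).2

/-- Packaging an explicit witness. -/
theorem e5ShareStep_klE5Raise_of {C : ℝ} {u : ℝ → ℝ → ℝ} (hC : 0 ≤ C) (hu : ∀ r cc, 0 < u r cc) (hs : E5ShareStep P R C u) :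
    E5ShareStep P R (klE5Raise P R) (klE5ShareU P R) :=
  e5ShareStep_klE5Raise_of_exists ⟨(C, u), ⟨hC, hu⟩, hs⟩

/-- Share monotonicity: a larger share (same threshold) still satisfies the step. -/
theorem E5ShareStep.mono {C C' : ℝ} {u : ℝ → ℝ → ℝ} (h : E5ShareStep P R C u) (hCC : C ≤ C') (hP : 0 ≤ P.Klam) : E5ShareStep P R C' u := by
  intro G hG r hr cc hcc hcc3 μ hμ U hU hU9 hUu β hβ hβc L M _ _ hL hM n hn hnN hreg hH hF hX Λ hΛ Qm x y hx hy
  refine (h G hG r hr cc hcc hcc3 μ hμ U hU hU9 hUu β hβ hβc L M hL hM n hn hnN hreg hH hF hX Λ hΛ Qm x y hx hy).trans ?_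
  have h1 : (0 : ℝ) ≤ (P.Klam * U) ^ 3 := pow_nonneg (mul_nonneg hP hU.le) 3
  have h2 : (0 : ℝ) ≤ ((2 : ℝ) ^ n)⁻¹ := by positivity
  exact mul_le_mul_of_nonneg_right (mul_le_mul_of_nonneg_right hCC h1) h2

end Deferred

/-! ## §3 The BARE-lines variant (organisation of `klws_flow_source_eq`: `κ = 0`, input `𝒱_{n−1}[K_n]`) — same text over `klE5BlockBare`

Which variant `klEngQ8` reads is the pen's word once the (c) v2 lane fixes the line organisation of its X-majorant ((R47h)(2): default = the (R1′)
organisation of record ⇒ `klE5Raise`); the bare pair is provided so that either ruling needs no further definition. -/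

/-- **`E5ShareStepBare P R C u`** — `E5ShareStep` with the BARE block `klE5BlockBare` (lines `C^K_{>Λ} − C^K_{>Λ_{n−1}}` and their complement, no
self-energy dressing; carrier built on the full `𝒱_{n−1}[K_n]`). -/
def E5ShareStepBare (P : SplitConsts) (R : RenConsts) (C : ℝ) (u : ℝ → ℝ → ℝ) : Prop :=
  ∀ G : GeoConsts, G.WF → ∀ r : ℝ, (klEngQ7 P R).CR ≤ r →
    ∀ cc : ℝ, 0 < cc → cc ≤ klEngC₃6 P R →
      ∀ μ ∈ klWindowC, ∀ U : ℝ, 0 < U → U ≤ klEngU₀9 P R cc → U ≤ u r cc →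
        ∀ β : ℝ, klBetaMin ≤ β → β ≤ Real.exp (cc / U ^ 2) →
          ∀ (L M : ℕ) [NeZero L] [NeZero M], klEngL₃ β U ≤ L → klEngM₃ β U L ≤ M →
            ∀ n : ℕ, 1 ≤ n → n ≤ nScales β + 1 → IsKLRegime U cc (-(n : ℤ)) →
              HistP klPredsV17F2 L M G P ((klEngQ7 P R).withCR r) R β U μ 0 n →
                FrameOK R U (nScales β) μ (klFlowFrameU L M β U μ n) →
                  (∀ j ≤ n, LevelsUExportAt L M (klCU P R (klEngQ7 P R)) P β U μ j) →
                    ∀ Λ ∈ Set.Icc (klScale klE0 n) (klScale klE0 (n - 1)), ∀ Qm : TorusSite 2 L,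
                      ∀ x y : TorusSite 2 L × MatsubaraIdx M, x.1 ∈ klBall L μ 0 → y.1 ∈ klBall L μ 0 →
                        ‖klE5BlockBare L M β U μ (klFlowFrameU L M β U μ n) (n - 1) Λ Qm x y‖ * (klScale klE0 (n - 1) - klScale klE0 n) ≤
                          C * (P.Klam * U) ^ 3 * ((2 : ℝ) ^ n)⁻¹

section DeferredBare

variable (P : SplitConsts) (R : RenConsts)

/-- The deferred BARE E.5 package. -/
def klE5PkgBare : ℝ × (ℝ → ℝ → ℝ) :=
  open scoped Classical in
  if h : ∃ e : ℝ × (ℝ → ℝ → ℝ), IsE5Pkg e ∧ E5ShareStepBare P R e.1 e.2 then Classical.choose h else (0, fun _ _ => 1)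

/-- **`klE5RaiseBare P R`** — the deferred E.5 share of `CR` in the bare organisation. -/
def klE5RaiseBare : ℝ := (klE5PkgBare P R).1

/-- **`klE5ShareUBare P R r cc`** — its deferred coupling threshold. -/
def klE5ShareUBare : ℝ → ℝ → ℝ := (klE5PkgBare P R).2

/-- The deferred bare package is admissible (unconditionally). -/
theorem isE5Pkg_klE5PkgBare : IsE5Pkg (klE5PkgBare P R) := by
  classical
  unfold klE5PkgBare
  split_ifs with h
  · exact (Classical.choose_spec h).1
  · exact isE5Pkg_zero

/-- `0 ≤ klE5RaiseBare P R`. -/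
theorem klE5RaiseBare_nonneg : 0 ≤ klE5RaiseBare P R := (isE5Pkg_klE5PkgBare P R).1

/-- `0 < klE5ShareUBare P R r cc`. -/
theorem klE5ShareUBare_pos (r cc : ℝ) : 0 < klE5ShareUBare P R r cc := (isE5Pkg_klE5PkgBare P R).2 r cc

variable {P R}

/-- The bare step holds for the deferred bare pair as soon as it holds for some admissible package. -/
theorem e5ShareStepBare_klE5RaiseBare_of_exists (h : ∃ e : ℝ × (ℝ → ℝ → ℝ), IsE5Pkg e ∧ E5ShareStepBare P R e.1 e.2) :
    E5ShareStepBare P R (klE5RaiseBare P R) (klE5ShareUBare P R) := by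
  classical
  have hpkg : klE5PkgBare P R = Classical.choose h := by
    unfold klE5PkgBare
    rw [dif_pos h]
  unfold klE5RaiseBare klE5ShareUBare
  rw [hpkg]
  exact (Classical.choose_spec h).2

/-- Packaging an explicit witness (bare). -/
theorem e5ShareStepBare_klE5RaiseBare_of {C : ℝ} {u : ℝ → ℝ → ℝ} (hC : 0 ≤ C) (hu : ∀ r cc, 0 < u r cc) (hs : E5ShareStepBare P R C u) :
    E5ShareStepBare P R (klE5RaiseBare P R) (klE5ShareUBare P R) :=
  e5ShareStepBare_klE5RaiseBare_of_exists ⟨(C, u), ⟨hC, hu⟩, hs⟩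

end DeferredBare

end Summit.HubbardSuperconductivity.HubbardSuperconductivity.Theorems.KLRegimeSplit

end
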